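import Summits.CriticalPhenomena.PercolationContinuityZ3.Theorems.Transplant.BoxProdZ2TubeLevels
import Summits.CriticalPhenomena.PercolationContinuityZ3.Theorems.Transplant.KNCells2ChainSchedCells
import Summits.CriticalPhenomena.PercolationContinuityZ3.Theorems.Transplant.KNLevelsTargetChain
import HarnessLib

/-!
# The corridor chain and the face step of `X □ ℤ²` as target steps in a TUBE GRAPH `tubeGraph X π` (design (D), §11 v2 of
# HOME/ENTRY-SEED-STAR.md, lead rulings V56 / 14:05:55Z: "both chains are plain TUBE chains — `π = B(w₀, F b)` for `cond_j` via `cond_of_step`,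
# `π = B(w₀, E b)` for `hreach` via `hreach_of_chain_edge_sub`"; the per-level kit clause is p3-g2's `kitClauseQ` (BoxProdZ2KitAtQ) VERBATIM)

builds on p205010 (kernel theorem, internal audit signed; external expert review pending) — nothing in this file uses p205010.
Lane `prim-bschramm`, seat `prim-bschramm-p2` (order G4); helper file (`--supports stmt-CriticalPhenomena-4575`).

* §1 ONE STEP from planar box data: `TubeStepData` (`π`, planar source box `[lo, hi]`, planar region `Dpl`, target `T`, `Rlev N j₀ j₁`, source,
  support); `Lv = tubeLData X π lo hi root Sfin`, `Rg = π ×ˢ Dpl`, `tstep : TStep (tubeGraph X π)`; `encl_of_planar`, `prod_subset_X_zero`,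
  **`kitsAt_tstep`** — the packaging of `hface_j` (one Lemma-10 step from the face box, the `ℤ^d` model's `cond_of_face` shape; consumed by
  `KSchA.cond_of_step`, p217114) and of the root probe `hQ0`.
* §2 THE CORRIDOR CHAIN over the constant schedule `ChainPlanar.Sched` (87 steps): `TubeChainData` (`π`, cells, `x`, `du`, `t = r/4`, `R'`, …, rim
  parts `Rim i`); `stepL i`, `stepD i = π ×ˢ region_i`, true target `tgtT i = π ×ˢ core_{i+1} = X^{(i+1)}_0` (linked by construction), enlarged target
  `tgtE i = tgtT i ∪ Rim i`, `stepE i : TStep (tubeGraph X π)`; `encl`, `tgtT_subset_stepD`, `tgtE_sdiff_subset`, `cube_subset_X_zero`,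
  `tgtT_last_subset`, **`kitsAt_stepE`** — consumed by `KSchA.hreach_of_chain_edge_sub` (p216676) with `T' i := tgtT i`.
[cite: KozmaNitzan2024, §4 Lemma 10 (p. 17), Lemma 11 (p. 22), Lemma 12 (pp. 23–25), p. 30]
-/

noncomputable section

open MeasureTheory ProbabilityTheory
open scoped ENNReal

namespace Summit.CriticalPhenomena.PercolationContinuityZ3.Theorems

namespace Transplant

namespace BoxProdZ2

open Literature.Probability.Percolation Literature.Probability.LatticeModels SimpleGraph
open Literature.Probability.Percolation.KozmaNitzan
open Literature.Probability.Percolation.KozmaNitzan.Cells (sgOf sgOf_sign)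
open KNLevels ChainPlanar

variable {W : Type} [DecidableEq W] (X : SimpleGraph W) [X.LocallyFinite]

/-! ## §1 One step from planar box data -/

/-- **The data of one target step in a tube graph** from planar box data. [cite: KozmaNitzan2024, §4 Lemma 10 (p. 17)] -/
structure TubeStepData (W : Type) where
  /-- the fibre window -/
  π : Finset W
  /-- lower corner of the planar source box -/
  lo : Site 2
  /-- upper corner of the planar source box -/
  hi : Site 2
  /-- the planar region -/
  Dpl : Finset (Site 2)
  /-- the target (enlarged: true target ∪ rim faces) -/
  T : Finset (W × Site 2)
  /-- the level depth -/
  Rlev : ℕ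
  /-- the number of contacts demanded by Step II -/
  N : ℕ
  /-- the level window -/
  j₀ : ℕ
  /-- the level window -/
  j₁ : ℕ
  /-- the source -/
  root : W × Site 2
  /-- the finite support of the weighting -/
  Sfin : Finset (W × Site 2)

namespace TubeStepData

variable {X} (P : TubeStepData W)

variable (X) in
/-- The level data: the tube levels of the planar box. [cite: KozmaNitzan2024, §4 Lemma 10 (p. 17)] -/
def Lv : LData (tubeGraph X P.π) := tubeLData X P.π P.lo P.hi P.root P.Sfin

/-- The region `π × Dpl`. [cite: KozmaNitzan2024, §4 Lemma 10 (p. 17: D)] -/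
def Rg : Finset (W × Site 2) := P.π ×ˢ P.Dpl

variable (X) in
/-- **The step.** [cite: KozmaNitzan2024, §4 Lemma 10 (p. 17)] -/
def tstep : TStep (tubeGraph X P.π) := ⟨P.Lv X, P.Rg, P.T, P.Rlev, P.N, P.j₀, P.j₁⟩

omit [DecidableEq W] [X.LocallyFinite] in
/-- The levels: `X_k = π × [lo - k, hi + k]`. [cite: KozmaNitzan2024, §4 p. 15 (B⟨j⟩)] -/
theorem Lv_X (k : ℕ) : (P.Lv X).X k = P.π ×ˢ Finset.Icc (P.lo - (k : Site 2)) (P.hi + (k : Site 2)) := by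
  rw [Lv, tubeLData_X]; rfl

omit [DecidableEq W] [X.LocallyFinite] in
/-- The source of the step. [folklore] -/
theorem tstep_o : (P.tstep X).L.o = P.root := rfl

omit [DecidableEq W] [X.LocallyFinite] in
/-- The target of the step. [folklore] -/
theorem tstep_T : (P.tstep X).T = P.T := rfl

omit [DecidableEq W] [X.LocallyFinite] in
/-- The region of the step. [folklore] -/
theorem tstep_D : (P.tstep X).D = P.π ×ˢ P.Dpl := rfl

variable {P}

omit [DecidableEq W] [X.LocallyFinite] in
/-- **`X_{Rlev+1} ⊆ D`** from the planar containment. [cite: KozmaNitzan2024, §4 Lemma 10 (p. 17: B⟨R+1⟩ ⊆ D)] -/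
theorem encl_of_planar (h : Finset.Icc (P.lo - ((P.Rlev + 1 : ℕ) : Site 2)) (P.hi + ((P.Rlev + 1 : ℕ) : Site 2)) ⊆ P.Dpl) :
    (P.Lv X).X (P.Rlev + 1) ⊆ P.Rg := by
  rw [Lv_X]; exact Finset.product_subset_product_right h

omit [DecidableEq W] [X.LocallyFinite] in
/-- **A product set over a planar subset of the box, with fibres in the window, lies in `X_0`** (for `hface : Face^{j+1} ⊆ X_0` and for the
wired root seed). [folklore] -/
theorem prod_subset_X_zero {π' : Finset W} {Pl : Finset (Site 2)} (hπ : π' ⊆ P.π) (hPl : Pl ⊆ Finset.Icc P.lo P.hi) :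
    π' ×ˢ Pl ⊆ (P.Lv X).X 0 := by
  rw [Lv_X]
  refine Finset.product_subset_product hπ ?_
  simpa using hPl

/-- **`KitsAt` of the step** from a subbox region in the tube graph, finite support, the source off the region, the planar enclosure, `T ⊆ D`
nonempty, the count inequality and the per-level kit clause — the latter is p3-g2's `kitClauseQ` verbatim. [cite: KozmaNitzan2024, §4 Lemma 10 (p. 17)] -/
theorem kitsAt_tstep {Wt : Sym2 (W × Site 2) → unitInterval} {p : unitInterval} {Δ : ℕ} {δ : ℝ}
    (hsub : KNLevels.IsSubbox (tubeGraph X P.π) Wt p P.Rg) (hfin : FinSupp Wt P.Sfin) (hDS : P.Rg ⊆ P.Sfin)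
    (hencl : Finset.Icc (P.lo - ((P.Rlev + 1 : ℕ) : Site 2)) (P.hi + ((P.Rlev + 1 : ℕ) : Site 2)) ⊆ P.Dpl)
    (ho : P.root ∉ P.Rg) (hoS : P.root ∈ P.Sfin) (hj : P.j₁ ≤ P.Rlev) (hTD : P.T ⊆ P.Rg) (hTne : P.T.Nonempty)
    (hcount : 1 / (1 - (p : ℝ)) ^ (Δ * P.N) ≤ δ * ((Finset.Icc P.j₀ P.j₁).card : ℝ))
    (hkits : ∀ j ∈ Finset.Icc P.j₀ P.j₁, ∃ (σ : SData (W × Site 2)) (S : Finset (W × Site 2)),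
      SHyp (tubeLData X P.π P.lo P.hi P.root P.Sfin) j σ ∧ σ.N ≤ P.N ∧
      (1 - (p : ℝ) ^ σ.sB) ^ σ.k ≤ δ ∧ S ⊆ (tubeLData X P.π P.lo P.hi P.root P.Sfin).X j ∧ S ⊆ P.Rg ∧
      (∀ x ∈ σ.K, ∀ e ∈ σ.seed x, e ∉ wireSet (↑S : Set (W × Site 2))) ∧ (∀ x ∈ σ.K, σ.face x ⊆ S) ∧
      (∀ x ∈ σ.K, 1 - 3 * δ ≤ (prodBernoulli Wt).real {ω | ∃ u ∈ σ.face x,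
        1 - δ < (prodBernoulli (pinW Wt (wireSet (↑S : Set (W × Site 2))) ω)).real
          (⋃ t ∈ P.T, openConnIn (↑P.Rg : Set (W × Site 2)) u t)})) :
    (P.tstep X).KitsAt Wt p Δ δ :=
  ⟨lhyp_tube X P.π P.lo P.hi hsub hfin hDS (encl_of_planar (X := X) hencl) ho hoS, hj, hTD, hTne, hcount, hkits⟩

end TubeStepData

/-! ## §2 The corridor chain over the constant schedule -/

/-- **The data of the corridor chain in a tube graph.** [cite: KozmaNitzan2024, §4 Lemma 12 (pp. 23–25)] -/
structure TubeChainData (W : Type) where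
  /-- the fibre window -/
  π : Finset W
  /-- the planar cells -/
  C : PCells
  /-- the examined macro-vertex `x` -/
  x : Site 2
  /-- the onward direction -/
  du : MDir
  /-- the planar unit `t = r / 4` -/
  t : ℕ
  /-- the planar neighbourhood radius `R' ≥ Rlev + 1` -/
  R' : ℕ
  /-- the level depth of every step -/
  Rlev : ℕ
  /-- the number of contacts demanded by Step II -/
  N : ℕ
  /-- the level window -/
  j₀ : ℕ
  /-- the level window -/
  j₁ : ℕ
  /-- the source -/
  root : W × Site 2
  /-- the finite support of the weighting -/
  Sfin : Finset (W × Site 2)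
  /-- the rim part of the enlarged target of step `i` -/
  Rim : ℕ → Finset (W × Site 2)

namespace TubeChainData

variable {X} (P : TubeChainData W)

/-- Lower corner of core `i`. [folklore] -/
def lo (i : ℕ) : Site 2 :=
  sLo P.du.1 (sgOf P.du) (P.C.cen P.x) (Sched.coreα P.t P.R' i) (Sched.coreβ P.t P.R' i) (Sched.coreW P.t P.R' i)

/-- Upper corner of core `i`. [folklore] -/
def hi (i : ℕ) : Site 2 :=
  sHi P.du.1 (sgOf P.du) (P.C.cen P.x) (Sched.coreα P.t P.R' i) (Sched.coreβ P.t P.R' i) (Sched.coreW P.t P.R' i)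

/-- The planar core `i`. [folklore] -/
def pcore (i : ℕ) : Finset (Site 2) := Sched.core P.t P.R' P.du.1 (sgOf P.du) (P.C.cen P.x) i

/-- The planar region `i`. [folklore] -/
def pregion (i : ℕ) : Finset (Site 2) := Sched.region P.t P.R' P.du.1 (sgOf P.du) (P.C.cen P.x) i

variable (X)

/-- **The level data of step `i`** (tube levels). [cite: KozmaNitzan2024, §4 Lemma 10 (p. 17)] -/
def stepL (i : ℕ) : LData (tubeGraph X P.π) := tubeLData X P.π (P.lo i) (P.hi i) P.root P.Sfin

/-- **The region of step `i`**: `π × region_i`. [cite: KozmaNitzan2024, §4 Lemma 10 (p. 17: D)] -/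
def stepD (i : ℕ) : Finset (W × Site 2) := P.π ×ˢ P.pregion i

/-- **The true target of step `i`**: `π × core_{i+1}`. [cite: KozmaNitzan2024, §4 Lemma 10 (p. 17: T)] -/
def tgtT (i : ℕ) : Finset (W × Site 2) := P.π ×ˢ P.pcore (i + 1)

/-- **The enlarged target of step `i`**: the true target and the rim part. [cite: KozmaNitzan2024, §4 p. 30] -/
def tgtE (i : ℕ) : Finset (W × Site 2) := P.tgtT i ∪ P.Rim i

/-- **Step `i` as a target step** (enlarged target). [cite: KozmaNitzan2024, §4 Lemma 12 (pp. 23–25)] -/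
def stepE (i : ℕ) : TStep (tubeGraph X P.π) := ⟨P.stepL X i, P.stepD i, P.tgtE i, P.Rlev, P.N, P.j₀, P.j₁⟩

/-! ### The levels, the link, the containments -/

omit [DecidableEq W] [X.LocallyFinite] in
/-- **The levels of step `i`**: `π × sBox(coreα i - j, coreβ i + j, coreW i + j)`. [cite: KozmaNitzan2024, §4 p. 15 (B⟨j⟩)] -/
theorem stepL_X (i j : ℕ) : (P.stepL X i).X j =
    P.π ×ˢ sBox P.du.1 (sgOf P.du) (P.C.cen P.x) (Sched.coreα P.t P.R' i - j) (Sched.coreβ P.t P.R' i + j) (Sched.coreW P.t P.R' i + j) := by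
  rw [stepL, tubeLData_X]
  show tubeLevel P.π (P.lo i) (P.hi i) j = _
  rw [tubeLevel, lo, hi, sBox_enlarge _ _ (sgOf_sign P.du)]

omit [DecidableEq W] [X.LocallyFinite] in
/-- The first level of step `i` is `π × core_i`. [folklore] -/
theorem stepL_X_zero (i : ℕ) : (P.stepL X i).X 0 = P.π ×ˢ P.pcore i := by
  rw [stepL, tubeLData_X]
  show tubeLevel P.π (P.lo i) (P.hi i) 0 = _
  rw [tubeLevel_zero]; rfl

omit [DecidableEq W] [X.LocallyFinite] in
/-- **The true targets link the chain**: `T'_i = X^{(i+1)}_0`. [cite: KozmaNitzan2024, §4 Lemma 12] -/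
theorem tgtT_eq_X_zero (i : ℕ) : P.tgtT i = (P.stepL X (i + 1)).X 0 := by
  rw [stepL_X_zero, tgtT]

omit [X.LocallyFinite] in
/-- So the true target of step `i` lies in the first level of step `i + 1`. [folklore] -/
theorem tgtT_subset_X_zero_succ (i : ℕ) : P.tgtT i ⊆ (P.stepE X (i + 1)).L.X 0 := by
  rw [P.tgtT_eq_X_zero X i]; exact subset_rfl

omit [X.LocallyFinite] in
/-- The true target lies in the enlarged target. [folklore] -/
theorem tgtT_subset_tgtE (i : ℕ) : P.tgtT i ⊆ (P.stepE X i).T := Finset.subset_union_left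

omit [X.LocallyFinite] in
/-- The excess part of the enlarged target is inside the rim part. [folklore] -/
theorem tgtE_sdiff_subset (i : ℕ) : (P.stepE X i).T \ P.tgtT i ⊆ P.Rim i := by
  intro v hv
  rw [Finset.mem_sdiff] at hv
  rcases Finset.mem_union.1 hv.1 with h | h
  · exact absurd h hv.2
  · exact h

omit [X.LocallyFinite] in
/-- The sources agree. [folklore] -/
theorem stepE_o (i : ℕ) : (P.stepE X i).L.o = P.root := rfl

variable {P}

omit [DecidableEq W] [X.LocallyFinite] in
/-- **`X^{(i)}_{Rlev+1} ⊆ D_i`** when `Rlev + 1 ≤ R'`. [cite: KozmaNitzan2024, §4 Lemma 10 (p. 17: B⟨R+1⟩ ⊆ D)] -/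
theorem encl (hR : 100 * P.R' ≤ P.t) (hRl : P.Rlev + 1 ≤ P.R') {i : ℕ} (hi : i ≤ Sched.nLast) :
    (P.stepL X i).X (P.Rlev + 1) ⊆ P.stepD i := by
  rw [stepL_X, stepD]
  refine Finset.product_subset_product_right
    ((sBox_mono (sgOf_sign P.du) _ ?_ ?_ ?_).trans (Sched.enlarge_core_subset_region (sgOf_sign P.du) _ hR hi)) <;> push_cast <;> omega

omit [DecidableEq W] in
/-- **`T'_i ⊆ D_i`.** [folklore] -/
theorem tgtT_subset_stepD (hR : 100 * P.R' ≤ P.t) {i : ℕ} (hi : i ≤ Sched.nLast) : P.tgtT i ⊆ P.stepD i :=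
  Finset.product_subset_product_right (Sched.core_succ_subset_region (sgOf_sign P.du) _ hR hi)

/-- **`T_i ⊆ D_i`** when the rim part lies in the region. [folklore] -/
theorem tgtE_subset_stepD (hR : 100 * P.R' ≤ P.t) (hRim : ∀ i, P.Rim i ⊆ P.stepD i) {i : ℕ} (hi : i ≤ Sched.nLast) :
    P.tgtE i ⊆ P.stepD i :=
  Finset.union_subset (tgtT_subset_stepD hR hi) (hRim i)

omit [DecidableEq W] in
/-- **`T'_i` is nonempty** as soon as the window is. [folklore] -/
theorem tgtT_nonempty (hR : 100 * P.R' ≤ P.t) (hπ : P.π.Nonempty) {i : ℕ} (hi : i ≤ Sched.nLast) : (P.tgtT i).Nonempty := by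
  obtain ⟨s, hs⟩ := Sched.core_nonempty (sgOf_sign P.du) (P.C.cen P.x) hR (by omega : i + 1 ≤ Sched.nLast + 1) (t := P.t) (R' := P.R') (a := P.du.1)
  obtain ⟨β, hβ⟩ := hπ
  exact ⟨(β, s), Finset.mem_product.2 ⟨hβ, hs⟩⟩

omit [DecidableEq W] in
/-- **`D_i ⊆ π × (Q_x ∪ H_{x,y})`** (`r = 4t`). [cite: KozmaNitzan2024, §4 p. 30 (E_{v,x} ∪ H_{x,y})] -/
theorem stepD_subset (hr : P.C.r = 4 * P.t) (hR : 100 * P.R' ≤ P.t) {i : ℕ} (hi : i ≤ Sched.nLast) :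
    P.stepD i ⊆ P.π ×ˢ (P.C.Q P.x ∪ P.C.Hfull P.x P.du) :=
  Finset.product_subset_product_right (Sched.region_subset_Q_union_Hfull hr hR hi)

omit [DecidableEq W] [X.LocallyFinite] in
/-- **The arrival cube lies in the first core**: `π' × M_x ⊆ X^{(0)}_0` for `π' ⊆ π`. [cite: KozmaNitzan2024, §4 p. 28 ((32): M_v)] -/
theorem cube_subset_X_zero (hr : P.C.r = 4 * P.t) (hR : 100 * P.R' ≤ P.t) {π' : Finset W} (hπ : π' ⊆ P.π) :
    π' ×ˢ P.C.M P.x ⊆ (P.stepL X 0).X 0 := by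
  rw [stepL_X_zero]
  refine Finset.product_subset_product hπ ?_
  rw [pcore, Sched.core_zero_eq_M hr hR]

omit [DecidableEq W] in
/-- **The last true target lies in `π × (M_y ∩ H_{x,y})`.** [cite: KozmaNitzan2024, §4 p. 26 (M_x, H_{v,x})] -/
theorem tgtT_last_subset (hr : P.C.r = 4 * P.t) (hR : 100 * P.R' ≤ P.t) :
    P.tgtT Sched.nLast ⊆ P.π ×ˢ (P.C.M (P.x + stepVec P.du) ∩ P.C.Hfull P.x P.du) :=
  Finset.product_subset_product_right (Finset.subset_inter (Sched.core_last_subset_M hr hR) (Sched.core_last_subset_Hfull hr hR))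

/-! ### The kits -/

/-- **`KitsAt` of the enlarged step `i`** from a subbox region in the tube graph, finite support, the source off the region, the count
inequality and the per-level kit clause towards the ENLARGED target (p3-g2's `kitClauseQ` verbatim: rim contacts by the face-in-target
shortcut, deep contacts by `kit_hIVQ`). [cite: KozmaNitzan2024, §4 Lemma 10 (p. 17)] -/
theorem kitsAt_stepE (hR : 100 * P.R' ≤ P.t) (hRl : P.Rlev + 1 ≤ P.R') (hRim : ∀ i, P.Rim i ⊆ P.stepD i) (hπ : P.π.Nonempty)
    {i : ℕ} (hi : i ≤ Sched.nLast) {Wt : Sym2 (W × Site 2) → unitInterval} {p : unitInterval} {Δ : ℕ} {δ : ℝ}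
    (hsub : KNLevels.IsSubbox (tubeGraph X P.π) Wt p (P.stepD i)) (hfin : FinSupp Wt P.Sfin) (hDS : P.stepD i ⊆ P.Sfin)
    (ho : P.root ∉ P.stepD i) (hoS : P.root ∈ P.Sfin) (hj : P.j₁ ≤ P.Rlev)
    (hcount : 1 / (1 - (p : ℝ)) ^ (Δ * P.N) ≤ δ * ((Finset.Icc P.j₀ P.j₁).card : ℝ))
    (hkits : ∀ j ∈ Finset.Icc P.j₀ P.j₁, ∃ (σ : SData (W × Site 2)) (S : Finset (W × Site 2)),
      SHyp (tubeLData X P.π (P.lo i) (P.hi i) P.root P.Sfin) j σ ∧ σ.N ≤ P.N ∧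
      (1 - (p : ℝ) ^ σ.sB) ^ σ.k ≤ δ ∧ S ⊆ (tubeLData X P.π (P.lo i) (P.hi i) P.root P.Sfin).X j ∧ S ⊆ P.stepD i ∧
      (∀ x ∈ σ.K, ∀ e ∈ σ.seed x, e ∉ wireSet (↑S : Set (W × Site 2))) ∧ (∀ x ∈ σ.K, σ.face x ⊆ S) ∧
      (∀ x ∈ σ.K, 1 - 3 * δ ≤ (prodBernoulli Wt).real {ω | ∃ u ∈ σ.face x,
        1 - δ < (prodBernoulli (pinW Wt (wireSet (↑S : Set (W × Site 2))) ω)).real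
          (⋃ t ∈ P.tgtE i, openConnIn (↑(P.stepD i) : Set (W × Site 2)) u t)})) :
    (P.stepE X i).KitsAt Wt p Δ δ :=
  ⟨lhyp_tube X P.π (P.lo i) (P.hi i) hsub hfin hDS (encl X hR hRl hi) ho hoS, hj, tgtE_subset_stepD hR hRim hi,
    (tgtT_nonempty hR hπ hi).mono (P.tgtT_subset_tgtE X i), hcount, hkits⟩

end TubeChainData

end BoxProdZ2

end Transplant

end Summit.CriticalPhenomena.PercolationContinuityZ3.Theorems

end
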